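import Summits.Ventures.CertifiedArithmetic.Expansions.Orient2dStageBBounds
import Mathlib.Tactic.Linarith
import Mathlib.Tactic.Positivity
import Mathlib.Tactic.Ring
import Mathlib.Tactic.NormNum

/-!
# Stage B of ORIENT2D, part 2: the stage-B test of `orient2dadapt` is sound

NEW WORK in the sense of this development (algorithm and constant: Shewchuk, `predicates.c` and
Table 1 line B; statement of correctness in this model and proof: ours).

* `orient2dStageB_correct` — **if stage A fell through and stage B returns `d`
  (`|det| ≥ ccwerrboundB ⊗ detsum`), then `d > 0 ↔ t_A > 0` and `d < 0 ↔ t_A < 0`** for the true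
  determinant `t_A = (a₁ − c₁)(b₂ − c₂) − (a₂ − c₂)(b₁ − c₁)` (so `d ≠ 0` and the returned sign is
  right): any precision `p ≥ 4`, any round-to-nearest with the `RoundoffBelow 2` property (e.g.
  ties-to-even), coordinates in a format `F(p, e₀)` with `emin ≤ e₀` and `emin + 2p ≤ 2e₀` (as for
  stage A: every rounding of the analysis is exact or of a normal number), error-free two-products on
  the rounded differences.  Proof: the `estimate` lemma of `Orient2dEstimate.lean` (a nonzero `det` has
  the sign of `Σ = x₁x₂ − x₃x₄`), `det ≠ 0` because `errbound > 0`, and the inequality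
  `stageB_sign_of_bounds` of part 1 fed with the roundoff facts of the floating-point operations
  involved (`Σ` has the sign of `t_A`).
* `orient2dStageB_fma` / `orient2dStageB_dekker` — the two-product assumption discharged for the
  2MultFMA two-product, and for Dekker's TWO-PRODUCT with `predicates.c`'s splitter (`p ≤ 2s ≤ p + 1`,
  `e₀ ≥ emin + p − 1`), both with ties-to-even.

STATE OF THE `orient2d` CERTIFICATION after this file: stage A
(`Literature/…/Shewchuk1997/Orient2dStageA.lean`), stage B (here), the tails-zero exit never returning
a wrong strict sign (`Orient2dEstimate.lean`) and the exactness of stage D (`Orient2d.lean`,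
`Orient2dPredicates.lean`) are machine-checked; NOT verified: stage C (`ccwerrboundC`,
`resulterrbound`) and that the tails-zero exit cannot return `0` for a nonzero determinant.
HONEST CAVEATS: overflow is not modelled (unbounded exponents); the format hypotheses exclude the
gradual-underflow range for the products (for binary64 — `p = 53`, `emin = −1074` — the coordinates
must be multiples of `2^−484`, e.g. any doubles of magnitude at least `2^−432`; not arbitrary doubles).

References: J. R. Shewchuk, Discrete Comput. Geom. 18 (1997) 305–363, §4.3 (Fig. 21, Table 1) and
`predicates.c` (`orient2d`, `orient2dadapt`) [Shewchuk1997].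
-/

namespace Summit.Ventures.CertifiedArithmetic.Expansions

open Literature.ComputerArithmetic.JeannerodRump2018
open Literature.ComputerArithmetic.BoldoJeannerodMelquiondMuller2023 hiding twoSum twoSum_fst isFloat_twoSum
open Literature.ComputerArithmetic.JoldesMullerPopescu2017 (isFloat_two_zpow abs_fl_le_of_abs_le)
open Literature.ComputerArithmetic.Shewchuk1997

variable {p : ℕ} {emin : ℤ} {fl : ℚ → ℚ}

/-! ## The stage-B test is sound -/

/-- **THE STAGE-B TEST OF `orient2dadapt` IS SOUND** (Table 1, line B: `ccwerrboundB = (2 + 12ε)ε`).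
Let `p ≥ 4`, `fl` any round-to-nearest into `F(p, emin)` with the `RoundoffBelow 2` property (e.g.
ties-to-even), the six coordinates floats of a format `F(p, e₀)` with `emin ≤ e₀` and
`emin + 2p ≤ 2e₀`, and the two-product routine error-free on the rounded differences.  If stage A
fell through (`orient2dStageA … = none`, any coefficient) and stage B returns `d`
(`|det| ≥ ccwerrboundB ⊗ detsum` with the `detsum` of stage A), then `d > 0 ↔ t_A > 0` and
`d < 0 ↔ t_A < 0` for the TRUE determinant `t_A = (a₁ − c₁)(b₂ − c₂) − (a₂ − c₂)(b₁ − c₁)`;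
in particular `d ≠ 0` and the returned sign is the true sign. -/
theorem orient2dStageB_correct (hp : 4 ≤ p) (hfl : IsRoundNearest p emin fl)
    (hfl2 : RoundoffBelow 2 fl) {e₀ : ℤ} (he₀ : emin ≤ e₀) (h2 : emin + 2 * p ≤ e₀ + e₀)
    {a₁ a₂ b₁ b₂ c₁ c₂ : ℚ} (ha₁ : IsFloat p e₀ a₁) (ha₂ : IsFloat p e₀ a₂) (hb₁ : IsFloat p e₀ b₁)
    (hb₂ : IsFloat p e₀ b₂) (hc₁ : IsFloat p e₀ c₁) (hc₂ : IsFloat p e₀ c₂)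
    {tp : ℚ → ℚ → ℚ × ℚ} (h₁₂ : ExactTwoProd p emin fl tp (fl (a₁ - c₁)) (fl (b₂ - c₂)))
    (h₃₄ : ExactTwoProd p emin fl tp (fl (a₂ - c₂)) (fl (b₁ - c₁))) {K : ℚ}
    (hA : orient2dStageA fl K a₁ a₂ b₁ b₂ c₁ c₂ = none) {d : ℚ}
    (hB : orient2dStageB tp fl (ccwerrboundB p) (orient2dDetsum fl a₁ a₂ b₁ b₂ c₁ c₂)
      a₁ a₂ b₁ b₂ c₁ c₂ = some d) :
    (0 < d ↔ 0 < (a₁ - c₁) * (b₂ - c₂) - (a₂ - c₂) * (b₁ - c₁)) ∧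
      (d < 0 ↔ (a₁ - c₁) * (b₂ - c₂) - (a₂ - c₂) * (b₁ - c₁) < 0) := by
  have hp1 : 1 ≤ p := le_trans (by norm_num) hp
  have he₂ : emin ≤ e₀ + e₀ := by omega
  have he₃ : emin ≤ -(2 * (p : ℤ)) + (e₀ + e₀) := by omega
  set u := unitRoundoff p with hu_def
  have hu0 : 0 < u := by rw [hu_def]; unfold unitRoundoff; positivity
  have hu16 : u ≤ 1 / 16 := Literature.ComputerArithmetic.BoldoMuller2011.unitRoundoff_le_sixteenth hp
  have hu1 : u < 1 := by linarith
  -- the quantities of the analysis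
  set t₁ := a₁ - c₁ with ht₁
  set t₂ := b₂ - c₂ with ht₂
  set t₃ := a₂ - c₂ with ht₃
  set t₄ := b₁ - c₁ with ht₄
  set x₁ := fl t₁ with hx₁
  set x₂ := fl t₂ with hx₂
  set x₃ := fl t₃ with hx₃
  set x₄ := fl t₄ with hx₄
  set x₅ := fl (x₁ * x₂) with hx₅
  set x₆ := fl (x₃ * x₄) with hx₆
  set S := orient2dDetsum fl a₁ a₂ b₁ b₂ c₁ c₂ with hS_def
  set det := orient2dDetB tp fl a₁ a₂ b₁ b₂ c₁ c₂ with hdet_def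
  -- grids and floats
  have gt₁ : OnGrid e₀ t₁ := (OnGrid.of_isFloat ha₁).sub (OnGrid.of_isFloat hc₁)
  have gt₂ : OnGrid e₀ t₂ := (OnGrid.of_isFloat hb₂).sub (OnGrid.of_isFloat hc₂)
  have gt₃ : OnGrid e₀ t₃ := (OnGrid.of_isFloat ha₂).sub (OnGrid.of_isFloat hc₂)
  have gt₄ : OnGrid e₀ t₄ := (OnGrid.of_isFloat hb₁).sub (OnGrid.of_isFloat hc₁)
  have gx₁ : OnGrid e₀ x₁ := gt₁.fl_of hp1 hfl he₀
  have gx₂ : OnGrid e₀ x₂ := gt₂.fl_of hp1 hfl he₀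
  have gx₃ : OnGrid e₀ x₃ := gt₃.fl_of hp1 hfl he₀
  have gx₄ : OnGrid e₀ x₄ := gt₄.fl_of hp1 hfl he₀
  have g₁₂ : OnGrid (e₀ + e₀) (x₁ * x₂) := gx₁.mul gx₂
  have g₃₄ : OnGrid (e₀ + e₀) (x₃ * x₄) := gx₃.mul gx₄
  have gx₅ : OnGrid (e₀ + e₀) x₅ := g₁₂.fl_of hp1 hfl he₂
  have gx₆ : OnGrid (e₀ + e₀) x₆ := g₃₄.fl_of hp1 hfl he₂
  have hx5F : IsFloat p emin x₅ := (hfl _).1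
  have hx6F : IsFloat p emin x₆ := (hfl _).1
  -- stage B returned: the test passed and `d = det`
  unfold orient2dStageB at hB
  simp only [] at hB
  rw [← hdet_def] at hB
  split_ifs at hB with hT
  obtain rfl := Option.some.inj hB
  -- what the fall-through of stage A gives: `detsum = s ± εs` on the grid `2^2e₀ ℤ`, `s > 0`
  have hft : (0 < x₅ ∧ 0 < x₆) ∨ (x₅ < 0 ∧ x₆ < 0) := orient2dStageA_eq_none hA
  have hSdef : S = if 0 < x₅ then fl (x₅ + x₆) else fl (-x₅ - x₆) := rfl
  have hSum : |(|x₅| + |x₆|) - S| ≤ u * (|x₅| + |x₆|) ∧ OnGrid (e₀ + e₀) S ∧ 0 < |x₅| + |x₆| := by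
    rcases hft with ⟨h5, h6⟩ | ⟨h5, h6⟩
    · rw [hSdef, if_pos h5]
      have hsum : x₅ + x₆ = |x₅| + |x₆| := by rw [abs_of_pos h5, abs_of_pos h6]
      refine ⟨?_, (gx₅.add gx₆).fl_of hp1 hfl he₂, by positivity⟩
      have h := abs_sub_fl_le_eps_mul_abs hp1 hfl he₂ (gx₅.add gx₆)
      rw [← hsum]
      rwa [abs_of_pos (by linarith : (0 : ℚ) < x₅ + x₆)] at h
    · rw [hSdef, if_neg (not_lt.mpr h5.le)]
      have hsum : -x₅ - x₆ = |x₅| + |x₆| := by rw [abs_of_neg h5, abs_of_neg h6]; ring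
      have hpos : 0 < |x₅| + |x₆| := by
        have := abs_pos.mpr h5.ne; positivity
      refine ⟨?_, (gx₅.neg.sub gx₆).fl_of hp1 hfl he₂, hpos⟩
      have h := abs_sub_fl_le_eps_mul_abs hp1 hfl he₂ (gx₅.neg.sub gx₆)
      rw [← hsum]
      rwa [abs_of_pos (by linarith : (0 : ℚ) < -x₅ - x₆)] at h
  obtain ⟨hS, gS, hs⟩ := hSum
  -- the error bound `E = ccwerrboundB ⊗ detsum`: `E = KS ± εKS`, `E > 0`, the test `E ≤ |det|`
  have gKS : OnGrid (-(2 * (p : ℤ)) + (e₀ + e₀)) (ccwerrboundB p * S) :=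
    (onGrid_ccwerrboundB p).mul gS
  have hS0 : 0 < S := by
    have h1 := (abs_sub_le_iff.mp hS).1
    have h2 := mul_pos (sub_pos.mpr hu1) hs
    linarith
  have hK0 : 0 < ccwerrboundB p := by unfold ccwerrboundB; positivity
  have hE : |(2 + 12 * u) * u * S - fl (ccwerrboundB p * S)| ≤ u * ((2 + 12 * u) * u * S) := by
    have h := abs_sub_fl_le_eps_mul_abs hp1 hfl he₃ gKS
    rw [abs_of_pos (mul_pos hK0 hS0)] at h
    have : (2 + 12 * u) * u * S = ccwerrboundB p * S := by rw [hu_def]; unfold ccwerrboundB; ring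
    rw [this]; exact h
  have hEpos : 0 < fl (ccwerrboundB p * S) :=
    (fl_pos_iff_of_onGrid hp1 hfl he₃ gKS).mpr (mul_pos hK0 hS0)
  have htest : fl (ccwerrboundB p * S) ≤ |det| := by
    rcases hT with h | h
    · exact h.trans (le_abs_self _)
    · exact h.trans (neg_le_abs _)
  have hdet0 : det ≠ 0 := by
    intro h; rw [h, abs_zero] at htest; linarith
  -- structural half: a nonzero `det` has the sign of `Σ = x₁x₂ − x₃x₄`
  have hsignB : (0 < det → 0 < x₁ * x₂ - x₃ * x₄) ∧ (det < 0 → x₁ * x₂ - x₃ * x₄ < 0) :=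
    orient2dDetB_sign hp1 hfl hfl2 h₁₂ h₃₄
  have hdetB : (0 < det ↔ 0 < x₁ * x₂ - x₃ * x₄) ∧ (det < 0 ↔ x₁ * x₂ - x₃ * x₄ < 0) := by
    rcases lt_or_gt_of_ne hdet0 with hneg | hpos
    · have hsig := hsignB.2 hneg
      exact ⟨⟨fun h => absurd h (not_lt.mpr hneg.le), fun h => absurd h (not_lt.mpr hsig.le)⟩,
        ⟨fun _ => hsig, fun _ => hneg⟩⟩
    · have hsig := hsignB.1 hpos
      exact ⟨⟨fun _ => hsig, fun _ => hpos⟩,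
        ⟨fun h => absurd h (not_lt.mpr hpos.le), fun h => absurd h (not_lt.mpr hsig.le)⟩⟩
  -- the block `B = ⟨B₀, B₁, B₂, B₃⟩` and its internals
  have hx5e : (tp x₁ x₂).1 = x₅ := h₁₂.1
  have hx6e : (tp x₃ x₄).1 = x₆ := h₃₄.1
  set a0 := (tp x₁ x₂).2 with ha0_def
  set b0 := (tp x₃ x₄).2 with hb0_def
  have ha0 : a0 = x₁ * x₂ - x₅ := by have := h₁₂.2.1; rw [hx5e] at this; linarith
  have hb0 : b0 = x₃ * x₄ - x₆ := by have := h₃₄.2.1; rw [hx6e] at this; linarith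
  have ha0F : IsFloat p emin a0 := h₁₂.2.2
  have hb0F : IsFloat p emin b0 := h₃₄.2.2
  have hblock : twoTwoProdDiff tp fl x₁ x₂ x₃ x₄ = twoTwoDiff fl x₅ a0 x₆ b0 := by
    show twoTwoDiff fl (tp x₁ x₂).1 a0 (tp x₃ x₄).1 b0 = _
    rw [hx5e, hx6e]
  rw [twoTwoDiff_eq] at hblock
  set T1 := twoSum fl (-b0) a0 with hT1
  set T2 := twoSum fl T1.1 x₅ with hT2
  set T3 := twoSum fl (-x₆) T2.2 with hT3
  set T4 := twoSum fl T3.1 T2.1 with hT4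
  have hT1F : IsFloat p emin T1.1 ∧ IsFloat p emin T1.2 := isFloat_twoSum hfl (-b0) a0
  have hT2F : IsFloat p emin T2.1 ∧ IsFloat p emin T2.2 := isFloat_twoSum hfl T1.1 x₅
  have hT3F : IsFloat p emin T3.1 ∧ IsFloat p emin T3.2 := isFloat_twoSum hfl (-x₆) T2.2
  have hT4F : IsFloat p emin T4.1 ∧ IsFloat p emin T4.2 := isFloat_twoSum hfl T3.1 T2.1
  have e1 : T1.2 = -b0 + a0 - fl (-b0 + a0) ∧ T1.1 + T1.2 = -b0 + a0 :=
    twoSum_exact hp1 hfl hb0F.neg ha0F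
  have e2 : T2.2 = T1.1 + x₅ - fl (T1.1 + x₅) ∧ T2.1 + T2.2 = T1.1 + x₅ :=
    twoSum_exact hp1 hfl hT1F.1 hx5F
  have e3 : T3.2 = -x₆ + T2.2 - fl (-x₆ + T2.2) ∧ T3.1 + T3.2 = -x₆ + T2.2 :=
    twoSum_exact hp1 hfl hx6F.neg hT2F.2
  have e4 : T4.2 = T3.1 + T2.1 - fl (T3.1 + T2.1) ∧ T4.1 + T4.2 = T3.1 + T2.1 :=
    twoSum_exact hp1 hfl hT3F.1 hT2F.1
  have hT11 : T1.1 = fl (-b0 + a0) := rfl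
  have hT41 : T4.1 = fl (T3.1 + T2.1) := rfl
  have gT11 : OnGrid emin T1.1 := OnGrid.of_isFloat hT1F.1
  have gT12 : OnGrid emin T1.2 := OnGrid.of_isFloat hT1F.2
  have gT21 : OnGrid emin T2.1 := OnGrid.of_isFloat hT2F.1
  have gT22 : OnGrid emin T2.2 := OnGrid.of_isFloat hT2F.2
  have gT31 : OnGrid emin T3.1 := OnGrid.of_isFloat hT3F.1
  have gT32 : OnGrid emin T3.2 := OnGrid.of_isFloat hT3F.2
  have gT41 : OnGrid emin T4.1 := OnGrid.of_isFloat hT4F.1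
  have gT42 : OnGrid emin T4.2 := OnGrid.of_isFloat hT4F.2
  -- `det = ((B₀ ⊕ B₁) ⊕ B₂) ⊕ B₃` and `Σ B = x₁x₂ − x₃x₄`
  have hdet : det = fl (fl (fl (T1.2 + T3.2) + T4.2) + T4.1) := by
    show estimate fl (twoTwoProdDiff tp fl x₁ x₂ x₃ x₄) = _
    rw [hblock, estimate_four]
  have hsig : T1.2 + T3.2 + T4.2 + T4.1 = x₁ * x₂ - x₃ * x₄ := by
    linarith [e1.2, e2.2, e3.2, e4.2]
  have hexp : IsExpansion 1 [T1.2, T3.2, T4.2, T4.1] := by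
    have h := (twoTwoProdDiff_spec hp1 hfl hfl2 h₁₂ h₃₄).1.isExpansion
    rwa [hblock] at h
  set B0 := T1.2 with hB0
  set B1 := T3.2 with hB1
  set B2 := T4.2 with hB2
  set B3 := T4.1 with hB3
  set Q1 := fl (B0 + B1) with hQ1
  set Q2 := fl (Q1 + B2) with hQ2
  have hQ1F : IsFloat p emin Q1 := (hfl _).1
  have hQ2F : IsFloat p emin Q2 := (hfl _).1
  -- the three roundings of `estimate` and the size of `B₂`
  have r1 : |B0 + B1 - Q1| ≤ u * |B0 + B1| :=
    abs_sub_fl_le_eps_mul_abs hp1 hfl le_rfl (gT12.add gT32)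
  have r2 : |Q1 + B2 - Q2| ≤ u * |Q1 + B2| :=
    abs_sub_fl_le_eps_mul_abs hp1 hfl le_rfl ((OnGrid.of_isFloat hQ1F).add gT42)
  have r3 : |Q2 + B3 - det| ≤ u * |det| := by
    rw [hdet]
    exact abs_sub_fl_le_eps_mul_abs_fl hp1 hfl le_rfl ((OnGrid.of_isFloat hQ2F).add gT41)
  have rB2 : |B2| ≤ u * |B3| := by
    have h : |T3.1 + T2.1 - fl (T3.1 + T2.1)| ≤ u * |fl (T3.1 + T2.1)| :=
      abs_sub_fl_le_eps_mul_abs_fl hp1 hfl le_rfl (gT31.add gT21)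
    rw [← e4.1, ← hT41] at h
    exact h
  have hdecomp : x₁ * x₂ - x₃ * x₄ - det = (B0 + B1 - Q1) + (Q1 + B2 - Q2) + (Q2 + B3 - det) := by
    rw [← hsig]; ring
  -- `Σ = det ± …` in one of the two shapes of the core lemma
  have hQ : (|(x₁ * x₂ - x₃ * x₄) - det| ≤ u * |det| + 3 * u ^ 2 * |B3| ∧
        |(x₁ * x₂ - x₃ * x₄) - B3| ≤ 2 * u * |B3|) ∨
      |(x₁ * x₂ - x₃ * x₄) - det| ≤ u * |det| + (u ^ 2 + 2 * u ^ 3 + u ^ 4 + u ^ 5) * (|x₅| + |x₆|) := by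
    by_cases hB2z : B2 = 0
    · -- `B₂ = 0`: `Q₂ = Q₁`, and `B₀, B₁` are tiny: `|B₀ + B₁| ≤ (ε + ε² + ε³ + ε⁴)s`
      right
      have hQ21 : Q2 = Q1 := by rw [hQ2, hB2z, add_zero]; exact fl_eq_self hfl hQ1F
      have ra0 : |a0| ≤ u * |x₅| := by
        rw [ha0]; exact abs_sub_fl_le_eps_mul_abs_fl hp1 hfl he₂ g₁₂
      have rb0 : |b0| ≤ u * |x₆| := by
        rw [hb0]; exact abs_sub_fl_le_eps_mul_abs_fl hp1 hfl he₂ g₃₄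
      have gab : OnGrid emin (-b0 + a0) := (OnGrid.of_isFloat hb0F).neg.add (OnGrid.of_isFloat ha0F)
      have rB0 : |B0| ≤ u * |-b0 + a0| := by
        rw [e1.1]; exact abs_sub_fl_le_eps_mul_abs hp1 hfl le_rfl gab
      have rT11 : |T1.1| ≤ (1 + u) * |-b0 + a0| := by
        have h := abs_sub_fl_le_eps_mul_abs hp1 hfl le_rfl gab
        rw [hT11]
        have := abs_sub_abs_le_abs_sub (fl (-b0 + a0)) (-b0 + a0)
        rw [abs_sub_comm (fl (-b0 + a0)) (-b0 + a0)] at this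
        linarith
      have rT22 : |T2.2| ≤ u * |T1.1 + x₅| := by
        rw [e2.1]
        exact abs_sub_fl_le_eps_mul_abs hp1 hfl le_rfl (gT11.add (OnGrid.of_isFloat hx5F))
      have rB1 : |B1| ≤ u * |-x₆ + T2.2| := by
        rw [e3.1]
        exact abs_sub_fl_le_eps_mul_abs hp1 hfl le_rfl ((OnGrid.of_isFloat hx6F).neg.add gT22)
      have hab : |-b0 + a0| ≤ u * (|x₅| + |x₆|) := by
        calc |-b0 + a0| ≤ |-b0| + |a0| := abs_add_le _ _
          _ = |b0| + |a0| := by rw [abs_neg]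
          _ ≤ u * |x₆| + u * |x₅| := add_le_add rb0 ra0
          _ = u * (|x₅| + |x₆|) := by ring
      have hB0' : |B0| ≤ u ^ 2 * (|x₅| + |x₆|) := by
        calc |B0| ≤ u * |-b0 + a0| := rB0
          _ ≤ u * (u * (|x₅| + |x₆|)) := mul_le_mul_of_nonneg_left hab hu0.le
          _ = u ^ 2 * (|x₅| + |x₆|) := by ring
      have hT22' : |T2.2| ≤ u * |x₅| + (u ^ 2 + u ^ 3) * (|x₅| + |x₆|) := by
        calc |T2.2| ≤ u * |T1.1 + x₅| := rT22
          _ ≤ u * (|T1.1| + |x₅|) := mul_le_mul_of_nonneg_left (abs_add_le _ _) hu0.le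
          _ ≤ u * ((1 + u) * (u * (|x₅| + |x₆|)) + |x₅|) := by
              apply mul_le_mul_of_nonneg_left _ hu0.le
              have := rT11.trans (mul_le_mul_of_nonneg_left hab (by linarith))
              linarith
          _ = u * |x₅| + (u ^ 2 + u ^ 3) * (|x₅| + |x₆|) := by ring
      have hB1' : |B1| ≤ u * |x₆| + u ^ 2 * |x₅| + (u ^ 3 + u ^ 4) * (|x₅| + |x₆|) := by
        calc |B1| ≤ u * |-x₆ + T2.2| := rB1
          _ ≤ u * (|-x₆| + |T2.2|) := mul_le_mul_of_nonneg_left (abs_add_le _ _) hu0.le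
          _ = u * (|x₆| + |T2.2|) := by rw [abs_neg]
          _ ≤ u * (|x₆| + (u * |x₅| + (u ^ 2 + u ^ 3) * (|x₅| + |x₆|))) :=
              mul_le_mul_of_nonneg_left (by linarith) hu0.le
          _ = u * |x₆| + u ^ 2 * |x₅| + (u ^ 3 + u ^ 4) * (|x₅| + |x₆|) := by ring
      have h01 : |B0 + B1| ≤ (u + u ^ 2 + u ^ 3 + u ^ 4) * (|x₅| + |x₆|) := by
        have hu2 : u ^ 2 * |x₅| ≤ u * |x₅| := by
          have h : u * u < u * 1 := mul_lt_mul_of_pos_left hu1 hu0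
          rw [mul_one, ← pow_two] at h
          exact mul_le_mul_of_nonneg_right h.le (abs_nonneg _)
        calc |B0 + B1| ≤ |B0| + |B1| := abs_add_le _ _
          _ ≤ u ^ 2 * (|x₅| + |x₆|) +
              (u * |x₆| + u ^ 2 * |x₅| + (u ^ 3 + u ^ 4) * (|x₅| + |x₆|)) := add_le_add hB0' hB1'
          _ ≤ (u + u ^ 2 + u ^ 3 + u ^ 4) * (|x₅| + |x₆|) := by linarith [hu2, abs_nonneg x₆]
      rw [hdecomp, hQ21]
      have hmid : Q1 + B2 - Q1 = 0 := by rw [hB2z]; ring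
      rw [hmid, add_zero]
      calc |(B0 + B1 - Q1) + (Q1 + B3 - det)| ≤ |B0 + B1 - Q1| + |Q1 + B3 - det| := abs_add_le _ _
        _ ≤ u * |B0 + B1| + u * |det| := by
            have r3' : |Q1 + B3 - det| ≤ u * |det| := by rw [← hQ21]; exact r3
            exact add_le_add r1 r3'
        _ ≤ u * ((u + u ^ 2 + u ^ 3 + u ^ 4) * (|x₅| + |x₆|)) + u * |det| := by
            have := mul_le_mul_of_nonneg_left h01 hu0.le
            linarith
        _ = u * |det| + (u ^ 2 + u ^ 3 + u ^ 4 + u ^ 5) * (|x₅| + |x₆|) := by ring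
        _ ≤ u * |det| + (u ^ 2 + 2 * u ^ 3 + u ^ 4 + u ^ 5) * (|x₅| + |x₆|) := by
            have : 0 ≤ u ^ 3 * (|x₅| + |x₆|) := by positivity
            linarith
    · -- `B₂ ≠ 0`: `|B₀ + B₁| < |B₂|` and `|Q₁| ≤ |B₂| ≤ ε|B₃|`
      left
      have hpw := hexp
      simp only [IsExpansion, List.pairwise_cons, List.mem_cons, List.mem_nil_iff, or_false,
        forall_eq_or_imp, forall_eq, List.Pairwise.nil, and_true] at hpw
      obtain ⟨⟨h01, h02, -⟩, ⟨h12, -⟩, -⟩ := hpw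
      obtain ⟨hlt, hle⟩ := abs_fl_add_le_of_below hp1 hfl hT1F.2 hT3F.2 hT4F.2 hB2z h01 h02 h12
      constructor
      · rw [hdecomp]
        calc |(B0 + B1 - Q1) + (Q1 + B2 - Q2) + (Q2 + B3 - det)|
              ≤ |(B0 + B1 - Q1) + (Q1 + B2 - Q2)| + |Q2 + B3 - det| := abs_add_le _ _
          _ ≤ |B0 + B1 - Q1| + |Q1 + B2 - Q2| + |Q2 + B3 - det| := by
              linarith [abs_add_le (B0 + B1 - Q1) (Q1 + B2 - Q2)]
          _ ≤ u * |B0 + B1| + u * |Q1 + B2| + u * |det| := add_le_add (add_le_add r1 r2) r3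
          _ ≤ u * |B2| + u * (|B2| + |B2|) + u * |det| := by
              have h1 : u * |B0 + B1| ≤ u * |B2| := mul_le_mul_of_nonneg_left hlt.le hu0.le
              have h2 : u * |Q1 + B2| ≤ u * (|B2| + |B2|) :=
                mul_le_mul_of_nonneg_left ((abs_add_le _ _).trans (by linarith)) hu0.le
              linarith
          _ = u * |det| + 3 * u * |B2| := by ring
          _ ≤ u * |det| + 3 * u * (u * |B3|) := by
              have := mul_le_mul_of_nonneg_left rB2 (by positivity : (0 : ℚ) ≤ 3 * u)
              linarith
          _ = u * |det| + 3 * u ^ 2 * |B3| := by ring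
      · have : x₁ * x₂ - x₃ * x₄ - B3 = (B0 + B1) + B2 := by rw [← hsig]; ring
        rw [this]
        calc |(B0 + B1) + B2| ≤ |B0 + B1| + |B2| := abs_add_le _ _
          _ ≤ |B2| + |B2| := by linarith
          _ ≤ u * |B3| + u * |B3| := add_le_add rB2 rB2
          _ = 2 * u * |B3| := by ring
  -- the numeric half: `Σ` has the sign of `t_A`
  have hnum := stageB_sign_of_bounds hu0 hu16
    (abs_sub_fl_le_eps_mul_abs_fl hp1 hfl he₀ gt₁) (abs_sub_fl_le_eps_mul_abs_fl hp1 hfl he₀ gt₂)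
    (abs_sub_fl_le_eps_mul_abs_fl hp1 hfl he₀ gt₃) (abs_sub_fl_le_eps_mul_abs_fl hp1 hfl he₀ gt₄)
    (abs_sub_fl_le_eps_mul_abs_fl hp1 hfl he₂ g₁₂) (abs_sub_fl_le_eps_mul_abs_fl hp1 hfl he₂ g₃₄)
    hQ hS hE hs htest
  exact ⟨hdetB.1.trans hnum.1, hdetB.2.trans hnum.2⟩

/-- **Stage B with the FMA two-product and ties-to-even** (the binary64 build of `predicates.c` on
FMA hardware, scaled: `p ≥ 4`, coordinates in `F(p, e₀)` with `emin ≤ e₀`, `emin + 2p ≤ 2e₀`): if stage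
A fell through and stage B returns `d`, then `d > 0 ↔ t_A > 0` and `d < 0 ↔ t_A < 0`. -/
theorem orient2dStageB_fma (hp : 4 ≤ p) {e₀ : ℤ} (he₀ : emin ≤ e₀) (h2 : emin + 2 * p ≤ e₀ + e₀)
    {a₁ a₂ b₁ b₂ c₁ c₂ : ℚ} (ha₁ : IsFloat p e₀ a₁) (ha₂ : IsFloat p e₀ a₂) (hb₁ : IsFloat p e₀ b₁)
    (hb₂ : IsFloat p e₀ b₂) (hc₁ : IsFloat p e₀ c₁) (hc₂ : IsFloat p e₀ c₂) {K : ℚ}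
    (hA : orient2dStageA (roundTiesEven p emin) K a₁ a₂ b₁ b₂ c₁ c₂ = none) {d : ℚ}
    (hB : orient2dStageB (twoProdFMA (roundTiesEven p emin)) (roundTiesEven p emin) (ccwerrboundB p)
      (orient2dDetsum (roundTiesEven p emin) a₁ a₂ b₁ b₂ c₁ c₂) a₁ a₂ b₁ b₂ c₁ c₂ = some d) :
    (0 < d ↔ 0 < (a₁ - c₁) * (b₂ - c₂) - (a₂ - c₂) * (b₁ - c₁)) ∧
      (d < 0 ↔ (a₁ - c₁) * (b₂ - c₂) - (a₂ - c₂) * (b₁ - c₁) < 0) := by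
  have hp1 : 1 ≤ p := le_trans (by norm_num) hp
  have he₂ : emin ≤ e₀ + e₀ := by omega
  have hfl : IsRoundNearest p emin (roundTiesEven p emin) := isRoundNearest_roundTiesEven hp1
  have hfl2 : RoundoffBelow 2 (roundTiesEven p emin) := roundoffBelow_two_roundTiesEven p emin
  -- a rounded difference of two floats of `F(p, e₀)` is again a float of `F(p, e₀)`
  have fmt : ∀ {x y : ℚ}, IsFloat p e₀ x → IsFloat p e₀ y →
      IsFloat p e₀ (roundTiesEven p emin (x - y)) := fun hx hy =>
    isFloat_of_isFloat_of_onGrid (hfl _).1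
      (((OnGrid.of_isFloat hx).sub (OnGrid.of_isFloat hy)).fl_of hp1 hfl he₀)
  exact orient2dStageB_correct hp hfl hfl2 he₀ h2 ha₁ ha₂ hb₁ hb₂ hc₁ hc₂
    (exactTwoProd_twoProdFMA hp1 hfl he₂ (fmt ha₁ hc₁) (fmt hb₂ hc₂))
    (exactTwoProd_twoProdFMA hp1 hfl he₂ (fmt ha₂ hc₂) (fmt hb₁ hc₁)) hA hB

/-- **Stage B with DEKKER's two-product and ties-to-even** (`predicates.c` as distributed: split point
`s` with `p ≤ 2s ≤ p + 1`, `p ≥ 4`; coordinates in `F(p, e₀)` with `e₀ ≥ emin + p − 1` and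
`2e₀ ≥ emin + 2p`, inside the no-underflow regime of Theorem 18): if stage A fell through and stage B
returns `d`, then `d > 0 ↔ t_A > 0` and `d < 0 ↔ t_A < 0`. -/
theorem orient2dStageB_dekker (hp : 4 ≤ p) {s : ℕ} (hs2 : p ≤ 2 * s) (hs2' : 2 * s ≤ p + 1)
    {e₀ : ℤ} (h1 : emin + p - 1 ≤ e₀) (h2 : emin + 2 * p ≤ e₀ + e₀)
    {a₁ a₂ b₁ b₂ c₁ c₂ : ℚ} (ha₁ : IsFloat p e₀ a₁) (ha₂ : IsFloat p e₀ a₂) (hb₁ : IsFloat p e₀ b₁)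
    (hb₂ : IsFloat p e₀ b₂) (hc₁ : IsFloat p e₀ c₁) (hc₂ : IsFloat p e₀ c₂) {K : ℚ}
    (hA : orient2dStageA (roundTiesEven p emin) K a₁ a₂ b₁ b₂ c₁ c₂ = none) {d : ℚ}
    (hB : orient2dStageB (twoProduct (roundTiesEven p emin) s) (roundTiesEven p emin)
      (ccwerrboundB p) (orient2dDetsum (roundTiesEven p emin) a₁ a₂ b₁ b₂ c₁ c₂)
      a₁ a₂ b₁ b₂ c₁ c₂ = some d) :
    (0 < d ↔ 0 < (a₁ - c₁) * (b₂ - c₂) - (a₂ - c₂) * (b₁ - c₁)) ∧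
      (d < 0 ↔ (a₁ - c₁) * (b₂ - c₂) - (a₂ - c₂) * (b₁ - c₁) < 0) := by
  have hp1 : 1 ≤ p := le_trans (by norm_num) hp
  have he₀ : emin ≤ e₀ := by omega
  have h2' : emin + 2 * p - 1 ≤ e₀ + e₀ := by omega
  have hfl : IsRoundNearest p emin (roundTiesEven p emin) := isRoundNearest_roundTiesEven hp1
  have hodd : ∀ t, roundTiesEven p emin (-t) = -roundTiesEven p emin t :=
    Literature.ComputerArithmetic.GraillatMuller2025.roundTiesEven_neg
  have hfl2 : RoundoffBelow 2 (roundTiesEven p emin) := roundoffBelow_two_roundTiesEven p emin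
  have fmt : ∀ {x y : ℚ}, IsFloat p e₀ x → IsFloat p e₀ y →
      IsFloat p e₀ (roundTiesEven p emin (x - y)) := fun hx hy =>
    isFloat_of_isFloat_of_onGrid (hfl _).1
      (((OnGrid.of_isFloat hx).sub (OnGrid.of_isFloat hy)).fl_of hp1 hfl he₀)
  exact orient2dStageB_correct hp hfl hfl2 he₀ h2 ha₁ ha₂ hb₁ hb₂ hc₁ hc₂
    (exactTwoProd_twoProduct hp hs2 hs2' hfl hodd h1 h2' (fmt ha₁ hc₁) (fmt hb₂ hc₂))
    (exactTwoProd_twoProduct hp hs2 hs2' hfl hodd h1 h2' (fmt ha₂ hc₂) (fmt hb₁ hc₁)) hA hB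

end Summit.Ventures.CertifiedArithmetic.Expansions
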